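import Summits.ABC.IUTFork.Conditional.RefBandsExactType557832031250
import Summits.ABC.IUTFork.Conditional.RefBandsExactType2707160810382798173125
import Summits.ABC.IUTFork.Conditional.Cor312LicenceTripleHullCellRefuteMPinned
import Summits.ABC.IUTFork.Cor312ThetaSideAssemblyM
import HarnessLib

/-!
# M LINE twins of the K-line TYPE-SPLIT REFUTED halves (REF under the lower local type at the split pole) — row «W:REF-EXACT-M-TWIN-2» item (3),
# residue «TS-REF»: 2 theorems from 2 K files

PROOF-ONLY file (D-0012; 0 definitions, 0 `Prop` facts, no instance, no notation) of the abc-iut cell — D-0079 RESCUE sub-cell R-W «WINDOW Θ-SIDE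
INEQUALITY», seat abc-iut-W-neg-1 (gen 7). TAKES NO SIDE on [IUTchIII] Cor. 3.12 (S. Mochizuki, *Inter-universal Teichmüller theory III*, Cor. 3.12
p. 173–174; Step (xi-f) p. 184) or on any author; «refuted as typed» ≠ «refuted in print».

WHY: on the TYPE-SPLIT rows of the R-W WINDOW-TABLE (one split pole `p ∣ ab`, kernel class `{e₀, 2e₀}·l`; «REF @ e = e₀·l · INH @ e = 2e₀·l»,
`plan/rescue/R-W/TS-BANDS.tsv`) the INHABITED halves have M-line twins (abc-iut-C-cert-2's `WRowM.licence_triple_<N>_typeband_e30_M` …) but the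
REFUTED-UNDER-TYPE halves — abc-iut-W-num-6's `WRow.not_licence_triple_<N>_typeband_of_fifteen` / `…_typelevels_of_fifteen` (`RefBandsExactType*`)
and abc-iut-w5-d009's `WRow.not_licence_frey37569208117_gap…_of_fifteen` («W:GAP-1019») — had none: their proofs go through w5-d009's K PINNED
socket `WRow.not_licence_triple_of_not_hullCell` (p493429), whose M port is this seat's gen-6 K-fibre→M socket
`GenuineM.not_pilotKummerCompatHull_triple_of_not_hullCell_kFibre` (`Cor312LicenceTripleHullCellRefuteMPinned`, p539835: the K-fibre exact local type
transfers to the M fibre by `WRowM.absRamificationIdx_kOfM_of_kFibre`). GENERATED (this seat's `gen_tsref_mtwin.py`): for each such K theorem the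
twin keeps the binders VERBATIM (level range, `T`, the K-fibre sub-class hypothesis `hloc : ∀ x₀ ∣ p, e(K_x₀/ℚ_p) ∣ 15·l` or its printed variant),
the K proof's prelude VERBATIM (class lemma `WRow.localType_class_triple_sharp` / `WRow.localType_seven_frey37569208117` sharpening `hloc` to the
exact type, the `v_p(abc)` evaluation, the integer cells `RefBand.typecells_…` / `WRow.not_hullCell_…` BY NAME) and replaces the final socket.
THEOREMS: `GenuineM.not_pilotKummerCompatHull_triple_557832031250_typeband_of_fifteen` (K `WRow.not_licence_triple_557832031250_typeband_of_fifteen`) ·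
`GenuineM.not_pilotKummerCompatHull_triple_2707160810382798173125_typeband_of_fifteen` (K
`WRow.not_licence_triple_2707160810382798173125_typeband_of_fifteen`).
READING (neutral; numbers, not adjectives): at these (triple, l), for every genuine datum IN THE SUB-CLASS `hloc`, the M books' per-datum S_H object
(binder `hSHw` of `Conditional.abc_of_SH_v11M_window` / `…_szpiroBadAll`) FAILS, exactly as the K books' does; the statement stays UNDER ITS CLAUSE
(the other class member is NOT refuted here — the desk reads it inhabited as typed); admissibility / Szpiro-badness / (P6) / NON-EMPTINESS of the
datum type and of the sub-class NOT claimed; the explicit hypothesis counts of the record books are UNCHANGED; an M twin changes NO census count.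
HONEST SCOPE: OUR sharp containers and Dupuy–Hilado's typed (Ind1)/(Ind2); STRONGER-THAN-PRINT set-level reading of Step (xi-f); nothing about the
printed GLOBAL inequality, the number-level `Cor22.Cor312AtDatum` or any author's intended hull; typed ≠ proved; instantiated ≠ endorsed; no abc
claim. [cite: Mochizuki2012, IUTchI Def. 3.1 (e) p. 62, Ex. 3.2 (iv) p. 71; IUTchIII Cor. 3.12 Step (xi-f) p. 184; IUTchIV Prop. 1.1 p. 9, Prop. 1.2
(i)(ii) p. 10, Cor. 2.2 (ii) proof (P5) p. 46] [cite: DupuyHilado2025, §3.3, §3.4, §4.9, §4.12] [cite: SerreLocalFields1979, Ch. III §6 Prop. 13]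
[claim: Mochizuki2012, status: disputed] for every IUT sentence.
-/

noncomputable section

open Set Function Metric NumberField IsDedekindDomain

namespace Summit.ABC.IUTFork.Conditional

open Thm311 Thm311.Real Cor312 Cor312Vol Cor312Prov Literature.IUT.LogThetaLattice Literature.IUT.LogVolume
  Literature.IUT.HodgeTheaters Literature.IUT.LogVolume.ThetaData Literature.IUT.LogVolume.Cor22
open Literature.NumberTheory.NumberFields Literature.NumberTheory.GaloisRepresentations.Ultrametric
open Literature.NumberTheory.DiophantineGeometry Literature.NumberTheory.DiophantineGeometry.GenEll Summit.ABC.ABC.Theorems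
open Summit.ABC.IUTFork.Repair.RH.HullThresholdExact Summit.ABC.IUTFork.Repair.RH.HullThresholdExactRefute

/-- **M-LINE TWIN (books' instance shape) of `WRow.not_licence_triple_557832031250_typeband_of_fifteen`** (`RefBandsExactType557832031250`): SAME binders — including the K-fibre local-type hypothesis `hloc` VERBATIM —
SAME cells / class lemma BY NAME, the K proof's prelude VERBATIM; the final socket is this seat's K-fibre→M socket
`GenuineM.not_pilotKummerCompatHull_triple_of_not_hullCell_kFibre` (p539835) at `placeOfPrimeQ p` instead of w5-d009's K pinned socket
`WRow.not_licence_triple_of_not_hullCell`. Conclusion: at such a datum (sub-class `hloc`) the M books' per-datum S_H object — `Cor312Vol.PilotKummerCompatHull` at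
`settingPrVolSharpM T.D … (tOfIdeleData T.D (ideleDataOf T.D T.isVolumeInputOf))`, own ideles, pinned q-reading — FAILS for every context / Kummer binder.
Refuted-as-typed UNDER THE LOCAL-TYPE CLAUSE only; the other member of the class, the inhabited side, admissibility / (P6) / non-emptiness (of the datum type
and of the sub-class) are NOT claimed. [cite: Mochizuki2012, IUTchIII Cor. 3.12 Step (xi-f) p. 184; IUTchIV Prop. 1.2 (i)(ii) p. 10, Cor. 2.2 (ii) proof (P5) p. 46]
[cite: DupuyHilado2025, §3.4, §4.9, §4.12] [claim: Mochizuki2012, status: disputed] -/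
theorem GenuineM.not_pilotKummerCompatHull_triple_557832031250_typeband_of_fifteen {l : ℕ} (hl : l.Prime) (hlo : 7 ≤ l) (hhi : l ≤ 3704) (hne : l ≠ 31)
    (T : Cor22.ThetaVolumeDatumAt (ratPoint (((2 * 5 ^ 10 * 13 ^ 4 : ℕ) : ℚ) / (11 ^ 8 * 109 ^ 2 * 3677 ^ 3 : ℕ))) l)
    (hloc : letI := T.instFieldF; letI := T.instNumberFieldF; letI := T.instAlgebraF; letI := T.instFieldK
      letI := T.instNumberFieldK; letI := T.instAlgebraK; letI := T.instFieldFbar; letI := T.instAlgebraFbar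
      letI := T.instAlgebraKFbar; letI := T.instIsElliptic
      haveI : Fact (Nat.Prime 31) := ⟨by norm_num⟩
      ∀ x₀ : (thetaIndex (pilotDataOfK T.D T.K)).Fibre (.inr ⟨31, by norm_num⟩),
        absRamificationIdx 31 (kOf (pilotDataOfK T.D T.K) 31 x₀) ∣ 15 * l) :
    letI := T.instFieldF; letI := T.instNumberFieldF; letI := T.instAlgebraF; letI := T.instFieldK
    letI := T.instNumberFieldK; letI := T.instAlgebraK; letI := T.instFieldFbar; letI := T.instAlgebraFbar
    letI := T.instAlgebraKFbar; letI := T.instIsElliptic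
    ∀ (M : Type) [Field M] [NumberField M]
      (archPk : ∀ (j : (thetaIndexOfInitial T.D).Label) (vQ : (thetaIndexOfInitial T.D).VQ),
        Set ((logShellsOfInitialDH T.D (analyticLogvVal T.K)).Packet j vQ))
      (archSub : ∀ (j : (thetaIndexOfInitial T.D).Label) (v : (thetaIndexOfInitial T.D).V),
        Set ((logShellsOfInitialDH T.D (analyticLogvVal T.K)).Packet j ((thetaIndexOfInitial T.D).over v)))
      (Ψ : ℤ → ∀ v : (thetaIndexOfInitial T.D).V, v ∈ (thetaIndexOfInitial T.D).Vbad →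
        Set ((logShellsOfInitialDH T.D (analyticLogvVal T.K)).StarPacket v))
      (act : ℤ → ∀ v : (thetaIndexOfInitial T.D).V, v ∈ (thetaIndexOfInitial T.D).Vbad →
        (logShellsOfInitialDH T.D (analyticLogvVal T.K)).StarPacket v →
          Module.End ℚ ((logShellsOfInitialDH T.D (analyticLogvVal T.K)).StarPacket v))
      (Mmod : ℤ → ∀ j : (thetaIndexOfInitial T.D).LabelStar, Set ((logShellsOfInitialDH T.D (analyticLogvVal T.K)).GlobalPacket j.1))
      (region : ℤ → ∀ j : (thetaIndexOfInitial T.D).LabelStar, FinDivisor M → ∀ vQ : (thetaIndexOfInitial T.D).VQ,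
        Set ((logShellsOfInitialDH T.D (analyticLogvVal T.K)).Packet j.1 vQ))
      (frobAdm : ℤ → ℤ → ∀ (j : (thetaIndexOfInitial T.D).Label) (vQ : (thetaIndexOfInitial T.D).VQ),
        Set ((logShellsOfInitialDH T.D (analyticLogvVal T.K)).Packet j vQ) → Prop)
      (frobLogvol : ℤ → ℤ → ∀ (j : (thetaIndexOfInitial T.D).Label) (vQ : (thetaIndexOfInitial T.D).VQ),
        Set ((logShellsOfInitialDH T.D (analyticLogvVal T.K)).Packet j vQ) → ℝ)
      (frobΨ : ℤ → ℤ → ∀ v : (thetaIndexOfInitial T.D).V, v ∈ (thetaIndexOfInitial T.D).Vbad →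
        Set ((logShellsOfInitialDH T.D (analyticLogvVal T.K)).StarPacket v))
      (frobMmod : ℤ → ℤ → ∀ j : (thetaIndexOfInitial T.D).LabelStar, Set ((logShellsOfInitialDH T.D (analyticLogvVal T.K)).GlobalPacket j.1))
      (unitImage : ℤ → ℤ → ℕ → ∀ (j : (thetaIndexOfInitial T.D).Label) (vQ : (thetaIndexOfInitial T.D).VQ),
        Set ((logShellsOfInitialDH T.D (analyticLogvVal T.K)).Packet j vQ))
      (ballImage : ℤ → ℤ → ∀ (j : (thetaIndexOfInitial T.D).Label) (vQ : (thetaIndexOfInitial T.D).VQ),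
        Set ((logShellsOfInitialDH T.D (analyticLogvVal T.K)).Packet j vQ))
      (thetaDiv : ℤ → ℤ → LgpDivisor M (thetaIndexOfInitial T.D).lstar)
      (n : ℤ) {HT : Type} {LogLink : HT → HT → Type} {IsFull : ∀ {s t : HT}, LogLink s t → Prop}
      (lat : LGPGaussianLogThetaLattice LogLink IsFull)
      {Frd : Type} {IsoF : Frd → Frd → Type} {Ob : Frd → Type} {realify : Frd → Frd} {Strip : Type}
      {IsoS : Strip → Strip → Type} {Mv : ∀ v : (thetaIndexOfInitial T.D).V, v ∈ (thetaIndexOfInitial T.D).Vbad → Type}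
      [∀ v h, Monoid (Mv v h)]
      (sig : GlobalLGPFrobenioidSignature (thetaIndexOfInitial T.D).lstar (thetaIndexOfInitial T.D).V
        (· ∈ (thetaIndexOfInitial T.D).Vbad) Frd IsoF Ob realify Strip IsoS Mv)
      (split : SplittingMonoids Mv) {ObΔ : Type} {N : ∀ v : (thetaIndexOfInitial T.D).V, v ∈ (thetaIndexOfInitial T.D).Vbad → Type}
      [∀ v h, Monoid (N v h)] (qData : QPilotData ObΔ N)
      (qK : ∀ v : (thetaIndexOfInitial T.D).V, v ∈ (thetaIndexOfInitial T.D).Vbad →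
        Set ((logShellsOfInitialDH T.D (analyticLogvVal T.K)).StarPacket v)),
      ¬ Cor312Vol.PilotKummerCompatHull
        (LatticeSituation.ofShells (logShellsOfInitialDH T.D (analyticLogvVal T.K)) M archPk archSub
          (summandPiecesPrM T.D (logvAnalyticVal_analyticLogvVal (K := T.K))).Adm (summandPiecesPrM T.D (logvAnalyticVal_analyticLogvVal (K := T.K))).logvol Ψ act Mmod region frobAdm frobLogvol
          frobΨ frobMmod unitImage ballImage thetaDiv)
        (settingPrVolSharpM T.D (logvAnalyticVal_analyticLogvVal (K := T.K)) (tOfIdeleData T.D (ideleDataOf T.D T.isVolumeInputOf))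
          (fun u x => tqM T.D (ratChar u) u (natCast_ratChar_mem u) (ideleDataOf T.D T.isVolumeInputOf) x) M archPk archSub Ψ act Mmod region n lat sig split qData
          (fun u x => tqM_ne_zero T.D (ratChar u) u (natCast_ratChar_mem u) (ideleDataOf T.D T.isVolumeInputOf) x)
          (GenuineM.finite_ratPlaces_under_S T.D).toFinset
          (fun u x hu => norm_tqM_eq_one_of_not_mem T.D (ratChar u) u (natCast_ratChar_mem u) (ideleDataOf T.D T.isVolumeInputOf) x
            fun hx => hu ((Set.Finite.mem_toFinset _).mpr ⟨x, hx⟩)))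
        (fun _ => Cor312.Setting.qRegion
          (settingPrVolSharpM T.D (logvAnalyticVal_analyticLogvVal (K := T.K)) (tOfIdeleData T.D (ideleDataOf T.D T.isVolumeInputOf))
          (fun u x => tqM T.D (ratChar u) u (natCast_ratChar_mem u) (ideleDataOf T.D T.isVolumeInputOf) x) M archPk archSub Ψ act Mmod region n lat sig split qData
          (fun u x => tqM_ne_zero T.D (ratChar u) u (natCast_ratChar_mem u) (ideleDataOf T.D T.isVolumeInputOf) x)
          (GenuineM.finite_ratPlaces_under_S T.D).toFinset
          (fun u x hu => norm_tqM_eq_one_of_not_mem T.D (ratChar u) u (natCast_ratChar_mem u) (ideleDataOf T.D T.isVolumeInputOf) x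
            fun hx => hu ((Set.Finite.mem_toFinset _).mpr ⟨x, hx⟩)))) qK := by
  letI := T.instFieldF; letI := T.instNumberFieldF; letI := T.instAlgebraF; letI := T.instFieldK
  letI := T.instNumberFieldK; letI := T.instAlgebraK; letI := T.instFieldFbar; letI := T.instAlgebraFbar
  letI := T.instAlgebraKFbar; letI := T.instIsElliptic
  have hp : Nat.Prime 31 := by norm_num
  have hodd : Odd l := hl.odd_of_ne_two (by omega)
  have hfac : (2 * 5 ^ 10 * 13 ^ 4 * (3 ^ 15 * 7 * 31 ^ 7 * 45817) * (11 ^ 8 * 109 ^ 2 * 3677 ^ 3)).factorization 31 = 7 := by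
    have hn : 2 * 5 ^ 10 * 13 ^ 4 * (3 ^ 15 * 7 * 31 ^ 7 * 45817) * (11 ^ 8 * 109 ^ 2 * 3677 ^ 3) = 31 ^ 7 * 325029159587525049346090949394611627538457031250 := by norm_num
    have hm : ¬ 31 ∣ 325029159587525049346090949394611627538457031250 := by norm_num
    show (2 * 5 ^ 10 * 13 ^ 4 * (3 ^ 15 * 7 * 31 ^ 7 * 45817) * (11 ^ 8 * 109 ^ 2 * 3677 ^ 3)).factorization 31 = 7
    rw [hn, Nat.factorization_mul (pow_ne_zero _ hp.ne_zero) (by norm_num), Finsupp.add_apply, hp.factorization_pow,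
      Finsupp.single_eq_same, Nat.factorization_eq_zero_of_not_dvd hm, add_zero]
  -- the sub-class `e ∣ 15·l` is the exact type `e = 15·l` (class lemma)
  have hloc' : letI := T.instFieldF; letI := T.instNumberFieldF; letI := T.instAlgebraF; letI := T.instFieldK
      letI := T.instNumberFieldK; letI := T.instAlgebraK; letI := T.instFieldFbar; letI := T.instAlgebraFbar
      letI := T.instAlgebraKFbar; letI := T.instIsElliptic
      haveI : Fact (Nat.Prime 31) := ⟨hp⟩
      ∀ x₀ : (thetaIndex (pilotDataOfK T.D T.K)).Fibre (.inr ⟨31, hp⟩),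
        absRamificationIdx 31 (kOf (pilotDataOfK T.D T.K) 31 x₀) = 15 * l := by
    intro x₀
    obtain ⟨A, hA, hA30, hA15, hAev, hA3, hA5, -⟩ := WRow.localType_class_triple_sharp isABCTriple_3677 T ⟨31, hp⟩ (by norm_num) (by norm_num)
      (by norm_num) (show (31 : ℕ) ≠ l by omega) (by norm_num) hfac x₀
    have hdiv : A * l ∣ 15 * l := hA ▸ hloc x₀
    have hAd : A ∣ 15 := Nat.dvd_of_mul_dvd_mul_right (by omega) hdiv
    have hAeq : A = 15 := by
      have hA31 : A ≤ 30 := Nat.le_of_dvd (by norm_num) hA30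
      interval_cases A <;> omega
    rw [hA, hAeq]
  have hP : 15 * l * (2 * 5 ^ 10 * 13 ^ 4 * (3 ^ 15 * 7 * 31 ^ 7 * 45817) * (11 ^ 8 * 109 ^ 2 * 3677 ^ 3)).factorization 31 = l * (15 * 7) := by
    rw [hfac]; ring
  clear hfac
  have hpe : ¬ (31 : ℕ) ∣ 15 * l := by
    intro h
    rcases (Nat.Prime.dvd_mul hp).mp h with h1 | h1
    · revert h1; norm_num
    · exact hne ((Nat.prime_dvd_prime_iff_eq hp hl).mp h1).symm
  obtain ⟨a₀, h1, h2, h3⟩ := RefBand.typecells_557832031250_fifteen hlo hhi hodd (i := (l - 1) / 2 - 1) (by omega)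
  exact GenuineM.not_pilotKummerCompatHull_triple_of_not_hullCell_kFibre isABCTriple_3677 T (placeOfPrimeQ 31 (by norm_num)) 31 (ratChar_placeOfPrimeQ 31 (by norm_num)) hp (by norm_num) (show (31 : ℕ) ≠ l by omega)
    (by norm_num) (e₀ := 15 * l) (P := 15 * 7) (i := (l - 1) / 2 - 1) (a₀ := a₀) hpe hloc' hP (by omega) h1 h2 h3

/-- **M-LINE TWIN (books' instance shape) of `WRow.not_licence_triple_2707160810382798173125_typeband_of_fifteen`** (`RefBandsExactType2707160810382798173125`): SAME binders — including the K-fibre local-type hypothesis `hloc` VERBATIM —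
SAME cells / class lemma BY NAME, the K proof's prelude VERBATIM; the final socket is this seat's K-fibre→M socket
`GenuineM.not_pilotKummerCompatHull_triple_of_not_hullCell_kFibre` (p539835) at `placeOfPrimeQ p` instead of w5-d009's K pinned socket
`WRow.not_licence_triple_of_not_hullCell`. Conclusion: at such a datum (sub-class `hloc`) the M books' per-datum S_H object — `Cor312Vol.PilotKummerCompatHull` at
`settingPrVolSharpM T.D … (tOfIdeleData T.D (ideleDataOf T.D T.isVolumeInputOf))`, own ideles, pinned q-reading — FAILS for every context / Kummer binder.
Refuted-as-typed UNDER THE LOCAL-TYPE CLAUSE only; the other member of the class, the inhabited side, admissibility / (P6) / non-emptiness (of the datum type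
and of the sub-class) are NOT claimed. [cite: Mochizuki2012, IUTchIII Cor. 3.12 Step (xi-f) p. 184; IUTchIV Prop. 1.2 (i)(ii) p. 10, Cor. 2.2 (ii) proof (P5) p. 46]
[cite: DupuyHilado2025, §3.4, §4.9, §4.12] [claim: Mochizuki2012, status: disputed] -/
theorem GenuineM.not_pilotKummerCompatHull_triple_2707160810382798173125_typeband_of_fifteen {l : ℕ} (hl : l.Prime) (hlo : 7 ≤ l) (hhi : l ≤ 5645470) (hne : l ≠ 19)
    (T : Cor22.ThetaVolumeDatumAt (ratPoint (((5 ^ 4 * 19 ^ 13 * 103 : ℕ) : ℚ) / (3 ^ 19 * 11 ^ 4 * 463 ^ 5 : ℕ))) l)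
    (hloc : letI := T.instFieldF; letI := T.instNumberFieldF; letI := T.instAlgebraF; letI := T.instFieldK
      letI := T.instNumberFieldK; letI := T.instAlgebraK; letI := T.instFieldFbar; letI := T.instAlgebraFbar
      letI := T.instAlgebraKFbar; letI := T.instIsElliptic
      haveI : Fact (Nat.Prime 19) := ⟨by norm_num⟩
      ∀ x₀ : (thetaIndex (pilotDataOfK T.D T.K)).Fibre (.inr ⟨19, by norm_num⟩),
        absRamificationIdx 19 (kOf (pilotDataOfK T.D T.K) 19 x₀) ∣ 15 * l) :
    letI := T.instFieldF; letI := T.instNumberFieldF; letI := T.instAlgebraF; letI := T.instFieldK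
    letI := T.instNumberFieldK; letI := T.instAlgebraK; letI := T.instFieldFbar; letI := T.instAlgebraFbar
    letI := T.instAlgebraKFbar; letI := T.instIsElliptic
    ∀ (M : Type) [Field M] [NumberField M]
      (archPk : ∀ (j : (thetaIndexOfInitial T.D).Label) (vQ : (thetaIndexOfInitial T.D).VQ),
        Set ((logShellsOfInitialDH T.D (analyticLogvVal T.K)).Packet j vQ))
      (archSub : ∀ (j : (thetaIndexOfInitial T.D).Label) (v : (thetaIndexOfInitial T.D).V),
        Set ((logShellsOfInitialDH T.D (analyticLogvVal T.K)).Packet j ((thetaIndexOfInitial T.D).over v)))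
      (Ψ : ℤ → ∀ v : (thetaIndexOfInitial T.D).V, v ∈ (thetaIndexOfInitial T.D).Vbad →
        Set ((logShellsOfInitialDH T.D (analyticLogvVal T.K)).StarPacket v))
      (act : ℤ → ∀ v : (thetaIndexOfInitial T.D).V, v ∈ (thetaIndexOfInitial T.D).Vbad →
        (logShellsOfInitialDH T.D (analyticLogvVal T.K)).StarPacket v →
          Module.End ℚ ((logShellsOfInitialDH T.D (analyticLogvVal T.K)).StarPacket v))
      (Mmod : ℤ → ∀ j : (thetaIndexOfInitial T.D).LabelStar, Set ((logShellsOfInitialDH T.D (analyticLogvVal T.K)).GlobalPacket j.1))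
      (region : ℤ → ∀ j : (thetaIndexOfInitial T.D).LabelStar, FinDivisor M → ∀ vQ : (thetaIndexOfInitial T.D).VQ,
        Set ((logShellsOfInitialDH T.D (analyticLogvVal T.K)).Packet j.1 vQ))
      (frobAdm : ℤ → ℤ → ∀ (j : (thetaIndexOfInitial T.D).Label) (vQ : (thetaIndexOfInitial T.D).VQ),
        Set ((logShellsOfInitialDH T.D (analyticLogvVal T.K)).Packet j vQ) → Prop)
      (frobLogvol : ℤ → ℤ → ∀ (j : (thetaIndexOfInitial T.D).Label) (vQ : (thetaIndexOfInitial T.D).VQ),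
        Set ((logShellsOfInitialDH T.D (analyticLogvVal T.K)).Packet j vQ) → ℝ)
      (frobΨ : ℤ → ℤ → ∀ v : (thetaIndexOfInitial T.D).V, v ∈ (thetaIndexOfInitial T.D).Vbad →
        Set ((logShellsOfInitialDH T.D (analyticLogvVal T.K)).StarPacket v))
      (frobMmod : ℤ → ℤ → ∀ j : (thetaIndexOfInitial T.D).LabelStar, Set ((logShellsOfInitialDH T.D (analyticLogvVal T.K)).GlobalPacket j.1))
      (unitImage : ℤ → ℤ → ℕ → ∀ (j : (thetaIndexOfInitial T.D).Label) (vQ : (thetaIndexOfInitial T.D).VQ),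
        Set ((logShellsOfInitialDH T.D (analyticLogvVal T.K)).Packet j vQ))
      (ballImage : ℤ → ℤ → ∀ (j : (thetaIndexOfInitial T.D).Label) (vQ : (thetaIndexOfInitial T.D).VQ),
        Set ((logShellsOfInitialDH T.D (analyticLogvVal T.K)).Packet j vQ))
      (thetaDiv : ℤ → ℤ → LgpDivisor M (thetaIndexOfInitial T.D).lstar)
      (n : ℤ) {HT : Type} {LogLink : HT → HT → Type} {IsFull : ∀ {s t : HT}, LogLink s t → Prop}
      (lat : LGPGaussianLogThetaLattice LogLink IsFull)
      {Frd : Type} {IsoF : Frd → Frd → Type} {Ob : Frd → Type} {realify : Frd → Frd} {Strip : Type}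
      {IsoS : Strip → Strip → Type} {Mv : ∀ v : (thetaIndexOfInitial T.D).V, v ∈ (thetaIndexOfInitial T.D).Vbad → Type}
      [∀ v h, Monoid (Mv v h)]
      (sig : GlobalLGPFrobenioidSignature (thetaIndexOfInitial T.D).lstar (thetaIndexOfInitial T.D).V
        (· ∈ (thetaIndexOfInitial T.D).Vbad) Frd IsoF Ob realify Strip IsoS Mv)
      (split : SplittingMonoids Mv) {ObΔ : Type} {N : ∀ v : (thetaIndexOfInitial T.D).V, v ∈ (thetaIndexOfInitial T.D).Vbad → Type}
      [∀ v h, Monoid (N v h)] (qData : QPilotData ObΔ N)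
      (qK : ∀ v : (thetaIndexOfInitial T.D).V, v ∈ (thetaIndexOfInitial T.D).Vbad →
        Set ((logShellsOfInitialDH T.D (analyticLogvVal T.K)).StarPacket v)),
      ¬ Cor312Vol.PilotKummerCompatHull
        (LatticeSituation.ofShells (logShellsOfInitialDH T.D (analyticLogvVal T.K)) M archPk archSub
          (summandPiecesPrM T.D (logvAnalyticVal_analyticLogvVal (K := T.K))).Adm (summandPiecesPrM T.D (logvAnalyticVal_analyticLogvVal (K := T.K))).logvol Ψ act Mmod region frobAdm frobLogvol
          frobΨ frobMmod unitImage ballImage thetaDiv)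
        (settingPrVolSharpM T.D (logvAnalyticVal_analyticLogvVal (K := T.K)) (tOfIdeleData T.D (ideleDataOf T.D T.isVolumeInputOf))
          (fun u x => tqM T.D (ratChar u) u (natCast_ratChar_mem u) (ideleDataOf T.D T.isVolumeInputOf) x) M archPk archSub Ψ act Mmod region n lat sig split qData
          (fun u x => tqM_ne_zero T.D (ratChar u) u (natCast_ratChar_mem u) (ideleDataOf T.D T.isVolumeInputOf) x)
          (GenuineM.finite_ratPlaces_under_S T.D).toFinset
          (fun u x hu => norm_tqM_eq_one_of_not_mem T.D (ratChar u) u (natCast_ratChar_mem u) (ideleDataOf T.D T.isVolumeInputOf) x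
            fun hx => hu ((Set.Finite.mem_toFinset _).mpr ⟨x, hx⟩)))
        (fun _ => Cor312.Setting.qRegion
          (settingPrVolSharpM T.D (logvAnalyticVal_analyticLogvVal (K := T.K)) (tOfIdeleData T.D (ideleDataOf T.D T.isVolumeInputOf))
          (fun u x => tqM T.D (ratChar u) u (natCast_ratChar_mem u) (ideleDataOf T.D T.isVolumeInputOf) x) M archPk archSub Ψ act Mmod region n lat sig split qData
          (fun u x => tqM_ne_zero T.D (ratChar u) u (natCast_ratChar_mem u) (ideleDataOf T.D T.isVolumeInputOf) x)
          (GenuineM.finite_ratPlaces_under_S T.D).toFinset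
          (fun u x hu => norm_tqM_eq_one_of_not_mem T.D (ratChar u) u (natCast_ratChar_mem u) (ideleDataOf T.D T.isVolumeInputOf) x
            fun hx => hu ((Set.Finite.mem_toFinset _).mpr ⟨x, hx⟩)))) qK := by
  letI := T.instFieldF; letI := T.instNumberFieldF; letI := T.instAlgebraF; letI := T.instFieldK
  letI := T.instNumberFieldK; letI := T.instAlgebraK; letI := T.instFieldFbar; letI := T.instAlgebraFbar
  letI := T.instAlgebraKFbar; letI := T.instIsElliptic
  have hp : Nat.Prime 19 := by norm_num
  have hodd : Odd l := hl.odd_of_ne_two (by omega)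
  have hfac : (5 ^ 4 * 19 ^ 13 * 103 * (2 ^ 13 * 13 ^ 9 * 29 * 2441 * 7673 ^ 2) * (3 ^ 19 * 11 ^ 4 * 463 ^ 5)).factorization 19 = 13 := by
    have hn : 5 ^ 4 * 19 ^ 13 * 103 * (2 ^ 13 * 13 ^ 9 * 29 * 2441 * 7673 ^ 2) * (3 ^ 19 * 11 ^ 4 * 463 ^ 5) = 19 ^ 13 * 8438651768611320513972262150818287268539433274912865280000 := by norm_num
    have hm : ¬ 19 ∣ 8438651768611320513972262150818287268539433274912865280000 := by norm_num
    show (5 ^ 4 * 19 ^ 13 * 103 * (2 ^ 13 * 13 ^ 9 * 29 * 2441 * 7673 ^ 2) * (3 ^ 19 * 11 ^ 4 * 463 ^ 5)).factorization 19 = 13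
    rw [hn, Nat.factorization_mul (pow_ne_zero _ hp.ne_zero) (by norm_num), Finsupp.add_apply, hp.factorization_pow,
      Finsupp.single_eq_same, Nat.factorization_eq_zero_of_not_dvd hm, add_zero]
  -- the sub-class `e ∣ 15·l` is the exact type `e = 15·l` (class lemma)
  have hloc' : letI := T.instFieldF; letI := T.instNumberFieldF; letI := T.instAlgebraF; letI := T.instFieldK
      letI := T.instNumberFieldK; letI := T.instAlgebraK; letI := T.instFieldFbar; letI := T.instAlgebraFbar
      letI := T.instAlgebraKFbar; letI := T.instIsElliptic
      haveI : Fact (Nat.Prime 19) := ⟨hp⟩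
      ∀ x₀ : (thetaIndex (pilotDataOfK T.D T.K)).Fibre (.inr ⟨19, hp⟩),
        absRamificationIdx 19 (kOf (pilotDataOfK T.D T.K) 19 x₀) = 15 * l := by
    intro x₀
    obtain ⟨A, hA, hA30, hA15, hAev, hA3, hA5, -⟩ := WRow.localType_class_triple_sharp isABCTriple_463 T ⟨19, hp⟩ (by norm_num) (by norm_num)
      (by norm_num) (show (19 : ℕ) ≠ l by omega) (by norm_num) hfac x₀
    have hdiv : A * l ∣ 15 * l := hA ▸ hloc x₀
    have hAd : A ∣ 15 := Nat.dvd_of_mul_dvd_mul_right (by omega) hdiv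
    have hAeq : A = 15 := by
      have hA31 : A ≤ 30 := Nat.le_of_dvd (by norm_num) hA30
      interval_cases A <;> omega
    rw [hA, hAeq]
  have hP : 15 * l * (5 ^ 4 * 19 ^ 13 * 103 * (2 ^ 13 * 13 ^ 9 * 29 * 2441 * 7673 ^ 2) * (3 ^ 19 * 11 ^ 4 * 463 ^ 5)).factorization 19 = l * (15 * 13) := by
    rw [hfac]; ring
  clear hfac
  have hpe : ¬ (19 : ℕ) ∣ 15 * l := by
    intro h
    rcases (Nat.Prime.dvd_mul hp).mp h with h1 | h1
    · revert h1; norm_num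
    · exact hne ((Nat.prime_dvd_prime_iff_eq hp hl).mp h1).symm
  obtain ⟨a₀, h1, h2, h3⟩ := RefBand.typecells_2707160810382798173125_fifteen hlo hhi hodd (i := (l - 1) / 2 - 1) (by omega)
  exact GenuineM.not_pilotKummerCompatHull_triple_of_not_hullCell_kFibre isABCTriple_463 T (placeOfPrimeQ 19 (by norm_num)) 19 (ratChar_placeOfPrimeQ 19 (by norm_num)) hp (by norm_num) (show (19 : ℕ) ≠ l by omega)
    (by norm_num) (e₀ := 15 * l) (P := 15 * 13) (i := (l - 1) / 2 - 1) (a₀ := a₀) hpe hloc' hP (by omega) h1 h2 h3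

end Summit.ABC.IUTFork.Conditional

end
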